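/-
Copyright (c) 2026. All rights reserved.
Released under Apache 2.0 license as described in the file LICENSE.
Authors: abc-iut cell, wave-2 seat abc-iut-L3-t10 (gen 3; proof-only; row «LD-REPAIR» (A″): the injectivity-free
core of (I4′) from a per-level branch dictionary with covering kernels and good conjugator sets, and its compact
form (I4′)_cpt (cell ruling α12-1); after `stabBranchPair'_of_coveringDictionary'`).
-/
import Literature.AnabelianGeometry.SemiGraphs.TemperedBranchPairProducerGood
import HarnessLib

/-!
# [SemiAnbd] Thm 3.7 (iii), estrangement step: the injectivity-free core and the compact form (I4′)_cpt

Mochizuki, *Semi-graphs of anabelioids*, Publ. RIMS **42** (2006) [MochizukiSemiAnbd2006], Thm 3.7 (iii) with the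
author's *Comments* (2020), (6)(b); Remark 2.2.1 p. 24; Definition 2.2 (i) p. 23. Print p. 41 moves only a
COMPACT subgroup `H ⊆ π₁^temp(G)` through the finite levels.

PROOF-ONLY; no definitions (cell row «LD-REPAIR» (A″), ruling α12-1 of abc-iut-L3-lead; seat abc-iut-L3-t10 gen 3).
The proof of `stabBranchPair'_of_coveringDictionary'` (`TemperedBranchPairProducerGood.lean`) never uses the
injectivity of `ιQ : π₁^temp(𝒢) → Q`; it only hands it on. Since the finite Galois tower actually built in the
tree (a (T2)-tower, not proved cofinal among all finite étale coverings) need not act faithfully through its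
finite levels, global injectivity of `ιQ` is not available there, while injectivity ON COMPACT SUBGROUPS is
(cell finding F-t6g3-1; the v4 field `FiniteLevelDataCpt.stabBranchPairCpt'` of abc-iut-L3-t6 gen 3). Hence:

* `branchPairStab_of_coveringDictionary'` — the CORE: for fixed `Q`, `ιQ` (no injectivity hypothesis), a
  per-level dictionary with covering kernels `N j` and good conjugator sets satisfying (DB′), (DI′), (DN′), and a
  compatible finite-level branch-pair system, there are `v`, branches `b, b'` at `v`, an injective
  `ψ : Π_v → Q` and `x, x' ∈ Π_v` with distinct branch-cosets such that EVERY `g` fixing the system has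
  `ιQ g ∈ ψ(x Π_b x⁻¹) ∩ ψ(x' Π_{b'} x'⁻¹)` (the proof of `stabBranchPair'_of_coveringDictionary'` verbatim, its
  last line split off);
* `stabBranchPairCpt'_of_coveringDictionary'` — the COMPACT FORM (I4′)_cpt: with
  `hιC : ∀ C compact, Set.InjOn ιQ C`, the v4 field text (`∀ C, IsCompact C → … ∃ Q … Set.InjOn ιQ C ∧ … ∧
  ∀ g ∈ C, …`) at the given levels;
(The v3 shape with global injectivity handed on is `stabBranchPair'_of_coveringDictionary'` itself.)

Nothing here takes a side on [IUTchIII] Cor. 3.12.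
-/

namespace Literature.AnabelianGeometry.SemiGraphs

open CategoryTheory Topology
open scoped Pointwise

universe v u

namespace ProfiniteSemiGraph

variable {𝒢 : ProfiniteSemiGraph.{u}}

/-- **CORE of the identification (I4′), no injectivity of `ιQ` assumed or concluded**: from a per-level branch
dictionary in a compact overgroup with covering kernels `N j` and good conjugator sets satisfying (DB′), (DI′),
(DN′), every element of `π₁^temp(𝒢)` fixing a compatible finite-level branch-pair system is carried by `ιQ` into
the intersection of two distinct branch-conjugates `ψ(x Π_b x⁻¹) ∩ ψ(x' Π_{b'} x'⁻¹)` (Comments (6)(b)).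
[cite: MochizukiSemiAnbd2006, Thm. 3.7(iii) p.41] -/
theorem branchPairStab_of_coveringDictionary' (c : TemperedPiChart 𝒢)
    {J : Type v} [Preorder J] [IsDirectedOrder J]
    (level : J → SemiGraph.{u}) (levelAct : ∀ j, c.G →* Aut (level j))
    (levelTrans : ∀ ⦃i j : J⦄, i ≤ j → (level j ⟶ level i))
    (levelProj : ∀ j, level j ⟶ 𝒢.graph)
    (hprojTrans : ∀ ⦃i j : J⦄ (h : i ≤ j), levelTrans h ≫ levelProj i = levelProj j)
    (Q : Type u) [Group Q] [TopologicalSpace Q] [IsTopologicalGroup Q] [CompactSpace Q] [T2Space Q]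
    (ιQ : c.G →* Q)
    (qAct : ∀ j, Q →* Aut (level j)) (hqAct : ∀ (j : J) (g : c.G), qAct j (ιQ g) = levelAct j g)
    (N : J → Subgroup Q) (hNn : ∀ j, (N j).Normal) (hMo : ∀ j, IsOpen (N j : Set Q))
    (hManti : ∀ ⦃i j : J⦄, i ≤ j → N j ≤ N i)
    (hMbot : ∀ q : Q, (∀ j, q ∈ N j) → q = 1)
    (ψ : ∀ v : 𝒢.graph.Vertex, 𝒢.Gv v →* Q) (hψi : ∀ v, Function.Injective (ψ v))
    (hψc : ∀ v, Continuous (ψ v))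
    (rep : ∀ (j : J) (_ : (level j).Vertex) (v : 𝒢.graph.Vertex) (_ : Q) (_ : (level j).Branch), 𝒢.Gv v)
    (good : ∀ j, (level j).Vertex → Set Q) (good_nonempty : ∀ (j : J) (w : (level j).Vertex), (good j w).Nonempty)
    (good_isClosed : ∀ (j : J) (w : (level j).Vertex), IsClosed (good j w))
    (good_anti : ∀ ⦃i j : J⦄ (h : i ≤ j) (w : (level j).Vertex), good j w ⊆ good i ((levelTrans h).vertexMap w))
    (DB : ∀ (j : J) (w : (level j).Vertex) (v : 𝒢.graph.Vertex) (_ : (levelProj j).vertexMap w = v) (γ : Q),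
      γ ∈ good j w →
      ∀ (β : (level j).Branch) (_ : (level j).abuts β = some w) (b : 𝒢.graph.Branch)
        (_ : (levelProj j).branchMap β = b) (hb : 𝒢.graph.abuts b = some v),
        ∀ q : Q, ((qAct j q).hom.vertexMap w = w ∧ (qAct j q).hom.branchMap β = β) ↔
          q ∈ (((𝒢.branchSubgroup b v hb).map (MulAut.conj (rep j w v γ β)).toMonoidHom).map (ψ v)).map
            (MulAut.conj γ).toMonoidHom ⊔ N j)
    (DI : ∀ (j : J) (w : (level j).Vertex) (v : 𝒢.graph.Vertex) (_ : (levelProj j).vertexMap w = v) (γ : Q),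
      γ ∈ good j w →
      ∀ (β β' : (level j).Branch), (level j).abuts β = some w → (level j).abuts β' = some w →
        ∀ (b : 𝒢.graph.Branch) (hb : 𝒢.graph.abuts b = some v),
        (levelProj j).branchMap β = b → (levelProj j).branchMap β' = b → β ≠ β' →
        rep j w v γ β' ∉ (((N j).comap ((MulAut.conj γ).toMonoidHom.comp (ψ v)) : Subgroup (𝒢.Gv v)) :
          Set (𝒢.Gv v)) * {rep j w v γ β} * (𝒢.branchSubgroup b v hb : Set (𝒢.Gv v)))
    (DN : ∀ ⦃i j : J⦄ (h : i ≤ j) (w : (level j).Vertex) (v : 𝒢.graph.Vertex) (_ : (levelProj j).vertexMap w = v)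
      (γ : Q), γ ∈ good j w →
      ∀ (β : (level j).Branch), (level j).abuts β = some w → ∀ (b : 𝒢.graph.Branch)
        (hb : 𝒢.graph.abuts b = some v), (levelProj j).branchMap β = b →
        rep j w v γ β ∈ (((N i).comap ((MulAut.conj γ).toMonoidHom.comp (ψ v)) : Subgroup (𝒢.Gv v)) :
          Set (𝒢.Gv v)) * {rep i ((levelTrans h).vertexMap w) v γ ((levelTrans h).branchMap β)} *
            (𝒢.branchSubgroup b v hb : Set (𝒢.Gv v))) :
    -- the identification (I4′), as consumed by `noFixedBranchPairSystem_of_isTotallyEstranged'`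
    ∀ (j₀ : J) (w : ∀ i : {i : J // j₀ ≤ i}, (level i.1).Vertex)
      (β β' : ∀ i : {i : J // j₀ ≤ i}, (level i.1).Branch),
      (∀ i, β i ≠ β' i ∧ (level i.1).abuts (β i) = some (w i) ∧ (level i.1).abuts (β' i) = some (w i)) →
      (∀ ⦃i i' : {i : J // j₀ ≤ i}⦄ (h : i.1 ≤ i'.1), (levelTrans h).vertexMap (w i') = w i ∧
        (levelTrans h).branchMap (β i') = β i ∧ (levelTrans h).branchMap (β' i') = β' i) →
      ∃ (v : 𝒢.graph.Vertex) (b b' : 𝒢.graph.Branch)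
        (hb : 𝒢.graph.abuts b = some v) (hb' : 𝒢.graph.abuts b' = some v) (ψ' : 𝒢.Gv v →* Q) (x x' : 𝒢.Gv v),
        Function.Injective ψ' ∧ (b' ≠ b ∨ x⁻¹ * x' ∉ 𝒢.branchSubgroup b v hb) ∧
        ∀ g : c.G, (∀ i, (levelAct i.1 g).hom.vertexMap (w i) = w i ∧
          (levelAct i.1 g).hom.branchMap (β i) = β i ∧ (levelAct i.1 g).hom.branchMap (β' i) = β' i) →
          ιQ g ∈ ((𝒢.branchSubgroup b v hb).map (MulAut.conj x).toMonoidHom).map ψ' ⊓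
            ((𝒢.branchSubgroup b' v hb').map (MulAut.conj x').toMonoidHom).map ψ' := by
  classical
  intro j₀ w β β' hpair hcompat
  -- index type and the base vertex / branches
  let I := {i : J // j₀ ≤ i}
  haveI : IsDirectedOrder I := by
    refine ⟨fun a c => ?_⟩
    obtain ⟨k, hak, hck⟩ := exists_ge_ge a.1 c.1
    exact ⟨⟨k, a.2.trans hak⟩, hak, hck⟩
  let i₀ : I := ⟨j₀, le_rfl⟩
  haveI : Nonempty I := ⟨i₀⟩
  let v : 𝒢.graph.Vertex := (levelProj j₀).vertexMap (w i₀)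
  have hv : ∀ i : I, (levelProj i.1).vertexMap (w i) = v := by
    intro i
    have h1 := (hcompat (i := i₀) (i' := i) i.2).1
    have h2 := congrArg (fun φ => SemiGraph.Hom.vertexMap φ (w i)) (hprojTrans (i.2 : j₀ ≤ i.1))
    simp only [SemiGraph.comp_vertexMap, Function.comp_apply] at h2
    rw [h1] at h2
    exact h2.symm
  let b : 𝒢.graph.Branch := (levelProj j₀).branchMap (β i₀)
  let b' : 𝒢.graph.Branch := (levelProj j₀).branchMap (β' i₀)
  have hbi : ∀ i : I, (levelProj i.1).branchMap (β i) = b := by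
    intro i
    have h1 := (hcompat (i := i₀) (i' := i) i.2).2.1
    have h2 := congrArg (fun φ => SemiGraph.Hom.branchMap φ (β i)) (hprojTrans (i.2 : j₀ ≤ i.1))
    simp only [SemiGraph.comp_branchMap, Function.comp_apply] at h2
    rw [h1] at h2
    exact h2.symm
  have hb'i : ∀ i : I, (levelProj i.1).branchMap (β' i) = b' := by
    intro i
    have h1 := (hcompat (i := i₀) (i' := i) i.2).2.2
    have h2 := congrArg (fun φ => SemiGraph.Hom.branchMap φ (β' i)) (hprojTrans (i.2 : j₀ ≤ i.1))
    simp only [SemiGraph.comp_branchMap, Function.comp_apply] at h2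
    rw [h1] at h2
    exact h2.symm
  have hb : 𝒢.graph.abuts b = some v := by
    have := (levelProj j₀).abuts_branchMap (β i₀) (w i₀) (hpair i₀).2.1
    exact this
  have hb' : 𝒢.graph.abuts b' = some v := by
    have := (levelProj j₀).abuts_branchMap (β' i₀) (w i₀) (hpair i₀).2.2
    exact this
  -- STEP 1: a uniform GOOD conjugator `γ` (compactness of `Q`: the good sets are closed, nonempty, decreasing)
  let M : I → Subgroup Q := fun i => N i.1
  haveI hMn : ∀ i, (M i).Normal := fun i => hNn i.1
  let E : I → Set Q := fun i => good i.1 (w i)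
  have hEanti : ∀ ⦃i i' : I⦄, i ≤ i' → E i' ⊆ E i := by
    intro i i' h γ hγ
    have h1 := good_anti (show i.1 ≤ i'.1 from h) (w i') hγ
    rw [(hcompat (i := i) (i' := i') h).1] at h1
    exact h1
  have hEdir : Directed (· ⊇ ·) E := by
    intro i i'
    obtain ⟨k, hik, hi'k⟩ := exists_ge_ge i i'
    exact ⟨k, hEanti hik, hEanti hi'k⟩
  obtain ⟨γ, hγ'⟩ := IsCompact.nonempty_iInter_of_directed_nonempty_isCompact_isClosed E hEdir
    (fun i => good_nonempty _ _) (fun i => (good_isClosed _ _).isCompact) (fun i => good_isClosed _ _)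
  have hγ : ∀ i : I, γ ∈ good i.1 (w i) := fun i => Set.mem_iInter.mp hγ' i
  -- the transported level subgroups of `Π_v` and the reference embedding `f = conj γ ∘ ψ v`
  let f : 𝒢.Gv v →* Q := (MulAut.conj γ).toMonoidHom.comp (ψ v)
  have hf : Function.Injective f := (MulAut.conj γ).injective.comp (hψi v)
  have hfc : Continuous f := by
    show Continuous fun x => γ * (ψ v) x * γ⁻¹
    exact ((continuous_const.mul (hψc v)).mul continuous_const)
  let Mt : I → Subgroup (𝒢.Gv v) := fun i => (M i).comap f
  haveI hMtn : ∀ i, (Mt i).Normal := fun i => Subgroup.Normal.comap (hMn i) f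
  have hMto : ∀ i, IsOpen (Mt i : Set (𝒢.Gv v)) := fun i => (hMo i.1).preimage hfc
  -- STEP 2: uniform representatives `y`, `y'` by compactness of `Π_v`
  let B : Subgroup (𝒢.Gv v) := 𝒢.branchSubgroup b v hb
  let B' : Subgroup (𝒢.Gv v) := 𝒢.branchSubgroup b' v hb'
  let yi : ∀ i : I, 𝒢.Gv v := fun i => rep i.1 (w i) v γ (β i)
  let y'i : ∀ i : I, 𝒢.Gv v := fun i => rep i.1 (w i) v γ (β' i)
  have hDN : ∀ ⦃i i' : I⦄ (h : i ≤ i'), yi i' ∈ (Mt i : Set (𝒢.Gv v)) * {yi i} * (B : Set (𝒢.Gv v)) := by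
    intro i i' h
    have hw := (hcompat (i := i) (i' := i') h).1
    have hβ := (hcompat (i := i) (i' := i') h).2.1
    have := DN (show i.1 ≤ i'.1 from h) (w i') v (hv i') γ (hγ i') (β i') (hpair i').2.1 b hb (hbi i')
    simp only [hw, hβ] at this
    exact this
  have hDN' : ∀ ⦃i i' : I⦄ (h : i ≤ i'), y'i i' ∈ (Mt i : Set (𝒢.Gv v)) * {y'i i} * (B' : Set (𝒢.Gv v)) := by
    intro i i' h
    have hw := (hcompat (i := i) (i' := i') h).1
    have hβ := (hcompat (i := i) (i' := i') h).2.2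
    have := DN (show i.1 ≤ i'.1 from h) (w i') v (hv i') γ (hγ i') (β' i') (hpair i').2.2 b' hb' (hb'i i')
    simp only [hw, hβ] at this
    exact this
  -- the clopen decreasing double cosets
  have uniform : ∀ (B₀ : Subgroup (𝒢.Gv v)) (z : ∀ i : I, 𝒢.Gv v),
      (∀ ⦃i i' : I⦄, i ≤ i' → z i' ∈ (Mt i : Set (𝒢.Gv v)) * {z i} * (B₀ : Set (𝒢.Gv v))) →
      ∃ y : 𝒢.Gv v, ∀ i, y ∈ (Mt i : Set (𝒢.Gv v)) * {z i} * (B₀ : Set (𝒢.Gv v)) := by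
    intro B₀ z hz
    let E : I → Set (𝒢.Gv v) := fun i => (Mt i : Set (𝒢.Gv v)) * {z i} * (B₀ : Set (𝒢.Gv v))
    have hEne : ∀ i, (E i).Nonempty := fun i =>
      ⟨z i, mem_coe_mul_singleton_mul_coe.mpr ⟨1, (Mt i).one_mem, 1, B₀.one_mem, by simp⟩⟩
    have hEcl : ∀ i, IsClosed (E i) := fun i => (isClopen_coe_mul_singleton_mul_coe (hMto i) (z i)).1
    have hEanti : ∀ ⦃i i' : I⦄, i ≤ i' → E i' ⊆ E i := by
      intro i i' h x hx
      obtain ⟨m, hm, p, hp, rfl⟩ := mem_coe_mul_singleton_mul_coe.mp hx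
      have hzz : (Mt i : Set (𝒢.Gv v)) * {z i'} * (B₀ : Set _) = (Mt i : Set _) * {z i} * (B₀ : Set _) :=
        coe_mul_singleton_mul_coe_eq_of_mem (hz h)
      have hm' : m ∈ Mt i := by
        show f m ∈ M i
        exact hManti (show i.1 ≤ i'.1 from h) hm
      have : m * z i' * p ∈ (Mt i : Set (𝒢.Gv v)) * {z i'} * (B₀ : Set _) :=
        mem_coe_mul_singleton_mul_coe.mpr ⟨m, hm', p, hp, rfl⟩
      rw [hzz] at this
      exact this
    have hEdir : Directed (· ⊇ ·) E := by
      intro i i'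
      obtain ⟨k, hik, hi'k⟩ := exists_ge_ge i i'
      exact ⟨k, hEanti hik, hEanti hi'k⟩
    obtain ⟨y, hy⟩ := IsCompact.nonempty_iInter_of_directed_nonempty_isCompact_isClosed E hEdir hEne
      (fun i => (hEcl i).isCompact) hEcl
    exact ⟨y, fun i => Set.mem_iInter.mp hy i⟩
  obtain ⟨y, hy⟩ := uniform B yi hDN
  obtain ⟨y', hy'⟩ := uniform B' y'i hDN'
  -- STEP 3: the stabilisers of `(w i, β i)` in terms of the uniform `y`
  have stab_eq : ∀ (B₀ : Subgroup (𝒢.Gv v)) (z₀ z : 𝒢.Gv v) (i : I),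
      z ∈ (Mt i : Set (𝒢.Gv v)) * {z₀} * (B₀ : Set (𝒢.Gv v)) →
      (B₀.map (MulAut.conj z₀).toMonoidHom).map f ⊔ M i = (B₀.map (MulAut.conj z).toMonoidHom).map f ⊔ M i := by
    intro B₀ z₀ z i hz
    obtain ⟨m, hm, p, hp, rfl⟩ := mem_coe_mul_singleton_mul_coe.mp hz
    -- `(m z₀ p) B₀ (m z₀ p)⁻¹ = m (z₀ B₀ z₀⁻¹) m⁻¹`
    have h1 : B₀.map (MulAut.conj (m * z₀ * p)).toMonoidHom =
        (B₀.map (MulAut.conj z₀).toMonoidHom).map (MulAut.conj m).toMonoidHom := by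
      have hp' : B₀.map (MulAut.conj p).toMonoidHom = B₀ := by
        ext x; constructor
        · rintro ⟨q, hq, rfl⟩; exact B₀.mul_mem (B₀.mul_mem hp hq) (B₀.inv_mem hp)
        · intro hx; exact ⟨p⁻¹ * x * p, B₀.mul_mem (B₀.mul_mem (B₀.inv_mem hp) hx) hp, by simp [mul_assoc]⟩
      have hc : (MulAut.conj (m * z₀ * p)).toMonoidHom =
          ((MulAut.conj m).toMonoidHom.comp (MulAut.conj z₀).toMonoidHom).comp (MulAut.conj p).toMonoidHom := by
        ext x; simp [mul_assoc]
      rw [hc, ← Subgroup.map_map, ← Subgroup.map_map, hp']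
    rw [h1]
    -- `f ∘ conj m = conj (f m) ∘ f`, and `f m ∈ M i`
    have h2 : f.comp (MulAut.conj m).toMonoidHom = (MulAut.conj (f m)).toMonoidHom.comp f := by
      ext x; simp
    have h2' : ((B₀.map (MulAut.conj z₀).toMonoidHom).map (MulAut.conj m).toMonoidHom).map f =
        ((B₀.map (MulAut.conj z₀).toMonoidHom).map f).map (MulAut.conj (f m)).toMonoidHom := by
      rw [Subgroup.map_map, Subgroup.map_map, h2, Subgroup.map_map, Subgroup.map_map]
    rw [h2']
    exact (map_conj_sup_eq_of_mem (A := (B₀.map (MulAut.conj z₀).toMonoidHom).map f) hm).symm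
  have hstab : ∀ (i : I) (q : Q),
      ((qAct i.1 q).hom.vertexMap (w i) = w i ∧ (qAct i.1 q).hom.branchMap (β i) = β i) →
        q ∈ (B.map (MulAut.conj y).toMonoidHom).map f ⊔ M i := by
    intro i q hq
    have h := (DB i.1 (w i) v (hv i) γ (hγ i) (β i) (hpair i).2.1 b (hbi i) hb q).mp hq
    rw [Subgroup.map_map] at h
    change q ∈ (B.map (MulAut.conj (yi i)).toMonoidHom).map f ⊔ M i at h
    rwa [stab_eq B (yi i) y i (hy i)] at h
  have hstab' : ∀ (i : I) (q : Q),
      ((qAct i.1 q).hom.vertexMap (w i) = w i ∧ (qAct i.1 q).hom.branchMap (β' i) = β' i) →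
        q ∈ (B'.map (MulAut.conj y').toMonoidHom).map f ⊔ M i := by
    intro i q hq
    have h := (DB i.1 (w i) v (hv i) γ (hγ i) (β' i) (hpair i).2.2 b' (hb'i i) hb' q).mp hq
    rw [Subgroup.map_map] at h
    change q ∈ (B'.map (MulAut.conj (y'i i)).toMonoidHom).map f ⊔ M i at h
    rwa [stab_eq B' (y'i i) y' i (hy' i)] at h
  -- STEP 4: the limit, by `⋂_i K·M_i = K` for compact `K`
  have hMdir : ∀ i i' : I, ∃ k : I, M k ≤ M i ∧ M k ≤ M i' := by
    intro i i'
    obtain ⟨k, hik, hi'k⟩ := exists_ge_ge i i'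
    exact ⟨k, hManti (show i.1 ≤ k.1 from hik), hManti (show i'.1 ≤ k.1 from hi'k)⟩
  have hMbot' : ∀ q : Q, (∀ i : I, q ∈ M i) → q = 1 := by
    intro q hq
    apply hMbot
    intro j
    obtain ⟨k, hjk, hj₀k⟩ := exists_ge_ge j j₀
    exact hManti hjk (hq ⟨k, hj₀k⟩)
  have compactK : ∀ {B₀ : Subgroup (𝒢.Gv v)} (_ : IsCompact (B₀ : Set (𝒢.Gv v))) (z : 𝒢.Gv v),
      IsCompact (((B₀.map (MulAut.conj z).toMonoidHom).map f : Subgroup Q) : Set Q) := by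
    intro B₀ hB₀ z
    rw [Subgroup.coe_map, Subgroup.coe_map]
    refine (hB₀.image ?_).image hfc
    exact (continuous_const.mul continuous_id).mul continuous_const
  have hBc : IsCompact (B : Set (𝒢.Gv v)) := by
    show IsCompact ((𝒢.brHom b v hb).toMonoidHom.range : Set (𝒢.Gv v))
    rw [MonoidHom.coe_range]
    exact isCompact_range (𝒢.brHom b v hb).continuous
  have hB'c : IsCompact (B' : Set (𝒢.Gv v)) := by
    show IsCompact ((𝒢.brHom b' v hb').toMonoidHom.range : Set (𝒢.Gv v))
    rw [MonoidHom.coe_range]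
    exact isCompact_range (𝒢.brHom b' v hb').continuous
  -- membership modulo every level ⇒ membership
  have limit : ∀ {B₀ : Subgroup (𝒢.Gv v)} (hB₀ : IsCompact (B₀ : Set (𝒢.Gv v))) (z : 𝒢.Gv v) (q : Q),
      (∀ i : I, q ∈ (B₀.map (MulAut.conj z).toMonoidHom).map f ⊔ M i) →
      q ∈ (B₀.map (MulAut.conj z).toMonoidHom).map f := by
    intro B₀ hB₀ z q hq
    have hmem : q ∈ ⋂ i : I, (((B₀.map (MulAut.conj z).toMonoidHom).map f : Subgroup Q) : Set Q) * (M i : Set Q) := by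
      rw [Set.mem_iInter]
      intro i
      rw [← Subgroup.mul_normal]
      exact hq i
    rw [iInter_mul_coe_eq_of_isCompact M (fun i => hMo i.1) hMdir hMbot' (compactK hB₀ z)] at hmem
    exact hmem
  refine ⟨v, b, b', hb, hb', f, y, y', hf, ?_, fun g hg => ?_⟩
  · -- distinct branch-cosets
    by_cases hbb : b' = b
    · right
      intro hyy
      -- with `b' = b` the two branch subgroups agree
      have hBB : ∀ (b₁ : 𝒢.graph.Branch) (h₁ : 𝒢.graph.abuts b₁ = some v), b₁ = b →
          𝒢.branchSubgroup b₁ v h₁ = B := by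
        rintro b₁ h₁ rfl; rfl
      have hB'B : B' = B := hBB b' hb' hbb
      -- `y' ∈ M̃·y·B = M̃·y_{i₀}·B`
      have h1 : y' ∈ (Mt i₀ : Set (𝒢.Gv v)) * {yi i₀} * (B : Set (𝒢.Gv v)) := by
        rw [← coe_mul_singleton_mul_coe_eq_of_mem (hy i₀)]
        exact mem_coe_mul_singleton_mul_coe.mpr ⟨1, (Mt i₀).one_mem, y⁻¹ * y', hyy, by simp⟩
      -- `y'_{i₀} ∈ M̃·y'·B = M̃·y_{i₀}·B`, contradicting (DI)
      have h2 : y'i i₀ ∈ (Mt i₀ : Set (𝒢.Gv v)) * {y'} * (B : Set (𝒢.Gv v)) := by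
        have h3 := hy' i₀
        rw [hB'B] at h3
        rw [coe_mul_singleton_mul_coe_eq_of_mem h3]
        exact mem_coe_mul_singleton_mul_coe.mpr ⟨1, (Mt i₀).one_mem, 1, B.one_mem, by simp⟩
      rw [coe_mul_singleton_mul_coe_eq_of_mem h1] at h2
      exact DI j₀ (w i₀) v (hv i₀) γ (hγ i₀) (β i₀) (β' i₀) (hpair i₀).2.1 (hpair i₀).2.2 b hb
        (hbi i₀) (by rw [hb'i i₀]; exact hbb) (hpair i₀).1 h2
    · left; exact hbb
  · -- membership
    have hgq : ∀ i : I, (qAct i.1 (ιQ g)).hom.vertexMap (w i) = w i ∧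
        (qAct i.1 (ιQ g)).hom.branchMap (β i) = β i ∧ (qAct i.1 (ιQ g)).hom.branchMap (β' i) = β' i := by
      intro i; rw [hqAct]; exact hg i
    exact ⟨limit hBc y (ιQ g) fun i => hstab i (ιQ g) ⟨(hgq i).1, (hgq i).2.1⟩,
      limit hB'c y' (ιQ g) fun i => hstab' i (ιQ g) ⟨(hgq i).1, (hgq i).2.2⟩⟩


/-- **(I4′)_cpt from a per-level branch dictionary with covering kernels and good conjugator sets** (cell ruling
α12-1, the field `FiniteLevelDataCpt.stabBranchPairCpt'` of abc-iut-L3-t6 gen 3): as the core, with `ιQ`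
injective ON COMPACT SUBGROUPS (`hιC`; in the tree: open level kernels + free deck action + the fixed-point lemma,
abc-iut-L3-t6's `injOn_pi_descendBaseAut_proj_of_isCompact`) — print p. 41 moves only a compact `H`.
[cite: MochizukiSemiAnbd2006, Thm. 3.7(iii) p.41] -/
theorem stabBranchPairCpt'_of_coveringDictionary' (c : TemperedPiChart 𝒢)
    {J : Type v} [Preorder J] [IsDirectedOrder J]
    (level : J → SemiGraph.{u}) (levelAct : ∀ j, c.G →* Aut (level j))
    (levelTrans : ∀ ⦃i j : J⦄, i ≤ j → (level j ⟶ level i))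
    (levelProj : ∀ j, level j ⟶ 𝒢.graph)
    (hprojTrans : ∀ ⦃i j : J⦄ (h : i ≤ j), levelTrans h ≫ levelProj i = levelProj j)
    (Q : Type u) [Group Q] [TopologicalSpace Q] [IsTopologicalGroup Q] [CompactSpace Q] [T2Space Q]
    (ιQ : c.G →* Q) (hιC : ∀ C : Subgroup c.G, IsCompact (C : Set c.G) → Set.InjOn ιQ C)
    (qAct : ∀ j, Q →* Aut (level j)) (hqAct : ∀ (j : J) (g : c.G), qAct j (ιQ g) = levelAct j g)
    (N : J → Subgroup Q) (hNn : ∀ j, (N j).Normal) (hMo : ∀ j, IsOpen (N j : Set Q))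
    (hManti : ∀ ⦃i j : J⦄, i ≤ j → N j ≤ N i)
    (hMbot : ∀ q : Q, (∀ j, q ∈ N j) → q = 1)
    (ψ : ∀ v : 𝒢.graph.Vertex, 𝒢.Gv v →* Q) (hψi : ∀ v, Function.Injective (ψ v))
    (hψc : ∀ v, Continuous (ψ v))
    (rep : ∀ (j : J) (_ : (level j).Vertex) (v : 𝒢.graph.Vertex) (_ : Q) (_ : (level j).Branch), 𝒢.Gv v)
    (good : ∀ j, (level j).Vertex → Set Q) (good_nonempty : ∀ (j : J) (w : (level j).Vertex), (good j w).Nonempty)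
    (good_isClosed : ∀ (j : J) (w : (level j).Vertex), IsClosed (good j w))
    (good_anti : ∀ ⦃i j : J⦄ (h : i ≤ j) (w : (level j).Vertex), good j w ⊆ good i ((levelTrans h).vertexMap w))
    (DB : ∀ (j : J) (w : (level j).Vertex) (v : 𝒢.graph.Vertex) (_ : (levelProj j).vertexMap w = v) (γ : Q),
      γ ∈ good j w →
      ∀ (β : (level j).Branch) (_ : (level j).abuts β = some w) (b : 𝒢.graph.Branch)
        (_ : (levelProj j).branchMap β = b) (hb : 𝒢.graph.abuts b = some v),
        ∀ q : Q, ((qAct j q).hom.vertexMap w = w ∧ (qAct j q).hom.branchMap β = β) ↔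
          q ∈ (((𝒢.branchSubgroup b v hb).map (MulAut.conj (rep j w v γ β)).toMonoidHom).map (ψ v)).map
            (MulAut.conj γ).toMonoidHom ⊔ N j)
    (DI : ∀ (j : J) (w : (level j).Vertex) (v : 𝒢.graph.Vertex) (_ : (levelProj j).vertexMap w = v) (γ : Q),
      γ ∈ good j w →
      ∀ (β β' : (level j).Branch), (level j).abuts β = some w → (level j).abuts β' = some w →
        ∀ (b : 𝒢.graph.Branch) (hb : 𝒢.graph.abuts b = some v),
        (levelProj j).branchMap β = b → (levelProj j).branchMap β' = b → β ≠ β' →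
        rep j w v γ β' ∉ (((N j).comap ((MulAut.conj γ).toMonoidHom.comp (ψ v)) : Subgroup (𝒢.Gv v)) :
          Set (𝒢.Gv v)) * {rep j w v γ β} * (𝒢.branchSubgroup b v hb : Set (𝒢.Gv v)))
    (DN : ∀ ⦃i j : J⦄ (h : i ≤ j) (w : (level j).Vertex) (v : 𝒢.graph.Vertex) (_ : (levelProj j).vertexMap w = v)
      (γ : Q), γ ∈ good j w →
      ∀ (β : (level j).Branch), (level j).abuts β = some w → ∀ (b : 𝒢.graph.Branch)
        (hb : 𝒢.graph.abuts b = some v), (levelProj j).branchMap β = b →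
        rep j w v γ β ∈ (((N i).comap ((MulAut.conj γ).toMonoidHom.comp (ψ v)) : Subgroup (𝒢.Gv v)) :
          Set (𝒢.Gv v)) * {rep i ((levelTrans h).vertexMap w) v γ ((levelTrans h).branchMap β)} *
            (𝒢.branchSubgroup b v hb : Set (𝒢.Gv v))) :
    -- the identification (I4′)_cpt, field text of `FiniteLevelDataCpt.stabBranchPairCpt'`
    ∀ (C : Subgroup c.G), IsCompact (C : Set c.G) →
    ∀ (j₀ : J) (w : ∀ i : {i : J // j₀ ≤ i}, (level i.1).Vertex)
      (β β' : ∀ i : {i : J // j₀ ≤ i}, (level i.1).Branch),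
      (∀ i, β i ≠ β' i ∧ (level i.1).abuts (β i) = some (w i) ∧ (level i.1).abuts (β' i) = some (w i)) →
      (∀ ⦃i i' : {i : J // j₀ ≤ i}⦄ (h : i.1 ≤ i'.1), (levelTrans h).vertexMap (w i') = w i ∧
        (levelTrans h).branchMap (β i') = β i ∧ (levelTrans h).branchMap (β' i') = β' i) →
      ∃ (Q' : Type u) (_ : Group Q') (ιQ' : c.G →* Q') (v : 𝒢.graph.Vertex) (b b' : 𝒢.graph.Branch)
        (hb : 𝒢.graph.abuts b = some v) (hb' : 𝒢.graph.abuts b' = some v) (ψ' : 𝒢.Gv v →* Q') (x x' : 𝒢.Gv v),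
        Set.InjOn ιQ' C ∧ Function.Injective ψ' ∧ (b' ≠ b ∨ x⁻¹ * x' ∉ 𝒢.branchSubgroup b v hb) ∧
        ∀ g ∈ C, (∀ i, (levelAct i.1 g).hom.vertexMap (w i) = w i ∧
          (levelAct i.1 g).hom.branchMap (β i) = β i ∧ (levelAct i.1 g).hom.branchMap (β' i) = β' i) →
          ιQ' g ∈ ((𝒢.branchSubgroup b v hb).map (MulAut.conj x).toMonoidHom).map ψ' ⊓
            ((𝒢.branchSubgroup b' v hb').map (MulAut.conj x').toMonoidHom).map ψ' := by
  intro C hC j₀ w β β' hpair hcompat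
  obtain ⟨v, b, b', hb, hb', ψ', x, x', hψ', hdist, hmem⟩ :=
    branchPairStab_of_coveringDictionary' c level levelAct levelTrans levelProj hprojTrans Q ιQ qAct hqAct N hNn hMo hManti hMbot ψ hψi hψc rep good good_nonempty good_isClosed good_anti DB DI DN j₀ w β β' hpair hcompat
  exact ⟨Q, inferInstance, ιQ, v, b, b', hb, hb', ψ', x, x', hιC C hC, hψ', hdist, fun g _ hg => hmem g hg⟩

end ProfiniteSemiGraph

end Literature.AnabelianGeometry.SemiGraphs
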